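import Summits.ResolutionOfSingularities.ResolutionOfSingularities.Theorems.FrobeniusLadderFInjectiveMacaulayficationE8LineDeformedData
import HarnessLib

/-!
# The CUSP-DEGENERATE E8-LINE `g = s³ + (s−1)(z² + e²w⁵)`: weights, initial form, primality (crux `FInjectiveMacaulayfication`, hole #3)

Support file for crux stmt-ResolutionOfSingularities-15315 (`FrobeniusLadder.FInjectiveMacaulayfication`), chain w45a, hole #3;
SCOPING MEMO `L/res-L1-w45a-stub-2/SCOPING-fcusp-F3.md` §3/§6(i) (res-L1-w45a-stub-2, R11.5): the chart `U*` of idea-2's move 3 on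
`f_cusp/𝔽₃` carries the hypersurface `g = s³ + (s−1)(z̃² + e₁₀²w̃⁵)` (ANSWERS-r5 §2), bad exactly along `C̃″ = V(s,z̃,w̃)`, whose
`(10,15,6)`-weighted tangent cone along the stratum, `g₀ = s³ − z̃² − e²w̃⁵`, is an `E₈⁰` cone DEGENERATING at `e = 0`. Variables of
`MvPolynomial (Fin 4) k`: `(e, s, w̃, z̃) = (X 0, X 1, X 2, X 3)`, weights `(0,10,6,15)` (those of `E8LineGradedFiModel` /
`E8LineDeformedData`, so that the Veronese saturation `E8LineGradedFiModel.veroneseSplitting` is reused verbatim), `J = {1,2,3}`.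
THIS FILE: the `w`-order filtration data of `g` for the relative filtered engine `FilteredConeFiModelRel` — homogeneity of the two
pieces, the initial form and the vanishing of the lower components, `g₀ ≠ 0`, and the PRIMALITY of `(g)` (Eisenstein at the prime
`q = z̃² + e²w̃⁵` for the monic cubic `s³ + q·s − q` in `s`) with `x̄_v ≠ 0`. [OURS · L1 W4.5a] AI-written; AI review is weaker than
expert review. No statement of Hironaka2017 is used; no external fact. No definitions, no named facts. [folklore]
-/

set_option linter.dupNamespace false

noncomputable section

open Polynomial

namespace Summit.ResolutionOfSingularities.ResolutionOfSingularities.Theorems.FInjectiveMacaulayfication.CuspE8LineData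

open Summit.ResolutionOfSingularities.ResolutionOfSingularities.Theorems.FInjectiveMacaulayfication

/-! ## Homogeneity and the initial form -/

/-- `g₀ = s³ − z̃² − e²w̃⁵` is `(0,10,6,15)`-homogeneous of weight `30`. [folklore] -/
theorem g₀_isWeightedHomogeneous (k : Type) [Field k] :
    MvPolynomial.IsWeightedHomogeneous (![0, 10, 6, 15] : Fin 4 → ℕ)
      (MvPolynomial.X 1 ^ 3 - MvPolynomial.X 3 ^ 2 - MvPolynomial.X 0 ^ 2 * MvPolynomial.X 2 ^ 5 : MvPolynomial (Fin 4) k) 30 := by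
  rw [← MvPolynomial.mem_weightedHomogeneousSubmodule]
  refine Submodule.sub_mem _ (Submodule.sub_mem _ ?_ ?_) ?_ <;> rw [MvPolynomial.mem_weightedHomogeneousSubmodule]
  · simpa using (MvPolynomial.isWeightedHomogeneous_X k (![0, 10, 6, 15] : Fin 4 → ℕ) 1).pow 3
  · simpa using (MvPolynomial.isWeightedHomogeneous_X k (![0, 10, 6, 15] : Fin 4 → ℕ) 3).pow 2
  · simpa using ((MvPolynomial.isWeightedHomogeneous_X k (![0, 10, 6, 15] : Fin 4 → ℕ) 0).pow 2).mul
      ((MvPolynomial.isWeightedHomogeneous_X k (![0, 10, 6, 15] : Fin 4 → ℕ) 2).pow 5)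

/-- The tail `s·z̃² + s·e²w̃⁵` is `(0,10,6,15)`-homogeneous of weight `40`. [folklore] -/
theorem tail_isWeightedHomogeneous (k : Type) [Field k] :
    MvPolynomial.IsWeightedHomogeneous (![0, 10, 6, 15] : Fin 4 → ℕ)
      (MvPolynomial.X 1 * MvPolynomial.X 3 ^ 2 + MvPolynomial.X 1 * (MvPolynomial.X 0 ^ 2 * MvPolynomial.X 2 ^ 5) :
        MvPolynomial (Fin 4) k) 40 := by
  refine (?_ : MvPolynomial.IsWeightedHomogeneous _ _ 40).add ?_
  · simpa using (MvPolynomial.isWeightedHomogeneous_X k (![0, 10, 6, 15] : Fin 4 → ℕ) 1).mul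
      ((MvPolynomial.isWeightedHomogeneous_X k (![0, 10, 6, 15] : Fin 4 → ℕ) 3).pow 2)
  · simpa using (MvPolynomial.isWeightedHomogeneous_X k (![0, 10, 6, 15] : Fin 4 → ℕ) 1).mul
      (((MvPolynomial.isWeightedHomogeneous_X k (![0, 10, 6, 15] : Fin 4 → ℕ) 0).pow 2).mul
        ((MvPolynomial.isWeightedHomogeneous_X k (![0, 10, 6, 15] : Fin 4 → ℕ) 2).pow 5))

/-- `g = g₀ + tail`. [folklore] -/
theorem g_eq_add (k : Type) [Field k] (g : MvPolynomial (Fin 4) k)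
    (hg : g = MvPolynomial.X 1 ^ 3 + (MvPolynomial.X 1 - 1) * (MvPolynomial.X 3 ^ 2 + MvPolynomial.X 0 ^ 2 * MvPolynomial.X 2 ^ 5)) :
    g = (MvPolynomial.X 1 ^ 3 - MvPolynomial.X 3 ^ 2 - MvPolynomial.X 0 ^ 2 * MvPolynomial.X 2 ^ 5) +
      (MvPolynomial.X 1 * MvPolynomial.X 3 ^ 2 + MvPolynomial.X 1 * (MvPolynomial.X 0 ^ 2 * MvPolynomial.X 2 ^ 5)) := by
  rw [hg]; ring

/-- **Initial form**: `in_w g = g₀ = s³ − z̃² − e²w̃⁵` and every component of weight `< 30` vanishes. [folklore] -/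
theorem initialForm (k : Type) [Field k] (g : MvPolynomial (Fin 4) k)
    (hg : g = MvPolynomial.X 1 ^ 3 + (MvPolynomial.X 1 - 1) * (MvPolynomial.X 3 ^ 2 + MvPolynomial.X 0 ^ 2 * MvPolynomial.X 2 ^ 5)) :
    MvPolynomial.weightedHomogeneousComponent (![0, 10, 6, 15] : Fin 4 → ℕ) 30 g =
        MvPolynomial.X 1 ^ 3 - MvPolynomial.X 3 ^ 2 - MvPolynomial.X 0 ^ 2 * MvPolynomial.X 2 ^ 5 ∧
      ∀ m < 30, MvPolynomial.weightedHomogeneousComponent (![0, 10, 6, 15] : Fin 4 → ℕ) m g = 0 := by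
  classical
  have h30 : (MvPolynomial.X 1 ^ 3 - MvPolynomial.X 3 ^ 2 - MvPolynomial.X 0 ^ 2 * MvPolynomial.X 2 ^ 5 : MvPolynomial (Fin 4) k) ∈
      MvPolynomial.weightedHomogeneousSubmodule k (![0, 10, 6, 15] : Fin 4 → ℕ) 30 := by
    rw [MvPolynomial.mem_weightedHomogeneousSubmodule]; exact g₀_isWeightedHomogeneous k
  have h40 : (MvPolynomial.X 1 * MvPolynomial.X 3 ^ 2 + MvPolynomial.X 1 * (MvPolynomial.X 0 ^ 2 * MvPolynomial.X 2 ^ 5) :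
      MvPolynomial (Fin 4) k) ∈ MvPolynomial.weightedHomogeneousSubmodule k (![0, 10, 6, 15] : Fin 4 → ℕ) 40 := by
    rw [MvPolynomial.mem_weightedHomogeneousSubmodule]; exact tail_isWeightedHomogeneous k
  refine ⟨?_, fun m hm => ?_⟩
  · rw [g_eq_add k g hg, map_add, MvPolynomial.weightedHomogeneousComponent_of_mem h30,
      MvPolynomial.weightedHomogeneousComponent_of_mem h40, if_pos rfl, if_neg (by norm_num), add_zero]
  · rw [g_eq_add k g hg, map_add, MvPolynomial.weightedHomogeneousComponent_of_mem h30,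
      MvPolynomial.weightedHomogeneousComponent_of_mem h40, if_neg (by omega), if_neg (by omega), add_zero]

/-- `g₀ ≠ 0` (it takes the value `1` at `(0,1,0,0)`). [folklore] -/
theorem g₀_ne_zero (k : Type) [Field k] :
    (MvPolynomial.X 1 ^ 3 - MvPolynomial.X 3 ^ 2 - MvPolynomial.X 0 ^ 2 * MvPolynomial.X 2 ^ 5 : MvPolynomial (Fin 4) k) ≠ 0 := by
  intro h
  have h1 := congrArg (MvPolynomial.eval (![0, 1, 0, 0] : Fin 4 → k)) h
  simp at h1

end Summit.ResolutionOfSingularities.ResolutionOfSingularities.Theorems.FInjectiveMacaulayfication.CuspE8LineData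

end
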